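/-
Copyright (c) 2026 the pub-hodgecm-mathlib formalisation cell (harness21).  Prover seat hodgecm-mathlib-K2E3-p17 (g7), Track B «K2-LIT» ∕ h413
(`stmt-HodgeConjecture-24833`), line `K2_E3_EllipticInputs`, unit U12 §11, road (11-3-split-nsc), leaf (nsc-S-A′) (owner K2E3-p25 (g0)), brick (E4) =
(E4a): «A CONSTITUENT OF A PRINCIPAL SERIES OF `GL₃(F)` HAS A NON-ZERO BOREL JACQUET MODULE», modulo the weak 3-cell lemma (E4b).  2026-09-04.
-/
import Summits.HodgeConjecture.HodgeConjecture.Theorems.K2E3TwoBlockCuspidalSupportEmbedding   -- ★ F1 (K2E3-p24 (g0)): BZ77 Thm 2.5 road, `eq_id_of_monotone_surjective`; brings the parabolic ∕ Jacquet kit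
import Literature.NumberTheory.Automorphic.ParabolicIndGLNoSupercuspidalSubquotient                -- ★ Casselman Cor. 5.4.3 `intertwiningMap_subrepresentation_parabolicIndGL_eq_zero`
import Literature.NumberTheory.Automorphic.ParabolicInductionSupercuspidalProofs                   -- ★ `isSupercuspidal_iff_jacquetGL_holds` (Harish-Chandra's criterion)
import Literature.NumberTheory.Automorphic.PAdicRepsJacquetAdmissibilityHolds                    -- ★ `jacquetAdmissibility_gl_holds` (irreducible smooth ⇒ admissible)
import Literature.NumberTheory.Automorphic.UnitaryGroupBorelInduction                            -- ★ `IrrClass.IsConstituentOf`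
import Literature.NumberTheory.Automorphic.JacquetGLFunctor                                      -- ★ `jacquetGLMap`, `jacquetGLMap_injective`, `jacquetGLMap_surjective`, `IntertwiningMap.rangeInverse`
import Literature.RepresentationTheory.FiniteGroups.EquivOfCharacter                             -- ★ `Subrepresentation.subtypeIntertwiningMap`
import HarnessLib

/-!
# K2_E3 road (h413), §11 (11-3-split-nsc), leaf (nsc-S-A′) — brick (E4a): every constituent of a principal series of `GL₃(F)` has non-zero Borel Jacquet
# module (Bernstein–Zelevinsky 1977, Thm. 2.9 ∕ Casselman 6.3.7 «the cuspidal support of a principal-series constituent is the torus»), modulo (E4b)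

Cell `pub/hodgecm-mathlib` (D-0151), Track B, seat K2E3-p17 (g7); dealt BY NAME by the leaf owner K2E3-p25 (g0) (K2 bus 2026-09-04 08:40:11Z «(E4) → K2E3-p17 (g7)»;
head shape = his display, `χ`-general).  `--supports stmt-HodgeConjecture-24833 --as helper`; THEOREMS ONLY (no definition ∕ instance ∕ notation ∕ named fact ∕ `sorry`);
never imports `Cruxes/…/Lines`.  COUNT-NEUTRAL; CONDITIONAL on the explicit hypothesis `h3cell` (the «weak 3-cell lemma», brick (E4b), after the leaf owner's E3).

THE MATHEMATICS.  `I(χ) = Ind_B^{GL₃}(χ)` (normalised, `B = P_{id}`), `χ` ANY character of the diagonal torus (no continuity needed); `r` an irreducible smooth constituent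
(subquotient `N₁ ⁄ N₂`, `N₂ ≤ N₁ ≤ I(χ)`) — so there is a SURJECTIVE intertwining map `q₁ : N₁ ↠ r`.  Suppose `r_B(r) = 0`.
(1) If `r` is supercuspidal, Casselman's Cor. 5.4.3 (★) says every map from a subrepresentation of `I(χ)` to `r` vanishes — but `q₁ ≠ 0`.
(2) If not, Harish-Chandra's criterion (★ `isSupercuspidal_iff_jacquetGL_holds`) gives a proper standard parabolic `P_c`, `c : Fin 3 → Fin k` monotone surjective,
with `r_c(r) ≠ 0`; `k = 3` would be the Borel (★ `eq_id_of_monotone_surjective`), so `k = 2`.  Every one-cut refinement of `c` is then the Borel labelling, whose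
Jacquet module vanishes, so `c` is Jacquet-minimal for `r`: as in [BZ77, Thm. 2.5] (★ road of F1: `exists_isCoatom_subrepresentation_jacquetGL`,
`coinvariantsKer_comp_cutUnipotent_eq_top`, `isSupercuspidal_of_forall_cut`) the finitely generated `r_c(r)` has an irreducible smooth SUPERCUSPIDAL quotient
`ψ : r_c(r) ↠ σ₀`.  The Jacquet functor is exact (★ `jacquetGLMap_injective` on `N₁ ↪ I(χ)`, ★ `jacquetGLMap_surjective` on `q₁`), so `σ₀` is a quotient of
the subrepresentation `r_c(N₁) ≅ (image) ≤ r_c(I(χ))` — contradicting `h3cell`: «no irreducible smooth supercuspidal representation of a two-block Levi is a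
quotient of a subrepresentation of `r_c(I(χ))`» (which is the 3-cell geometric lemma `r_c ∘ Ind_B` + Cor. 5.4.3 on the `GL₂` block, brick (E4b)).
[BernsteinZelevinsky1977, Thm. 2.5, Thm. 2.9, §2.3] [Casselman1995, Cor. 5.4.3, Thm. 6.3.7] [Zelevinsky1980, §1]
HONEST LABEL: HC_CM is proved only modulo the 7 printed citations (2 remaining named inputs: hLiu418 = stmt-HodgeConjecture-24832, h413 = stmt-HodgeConjecture-24833)
until rung 0 closes; count-neutral helper, CONDITIONAL on `h3cell` (E4b, OPEN).

## Mathlib ∕ tree search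
Tree: ★ `IrrClass.IsConstituentOf` (UnitaryGroupBorelInduction), ★ `IrrClass.mk_eq_mk_iff`, ★ Casselman `intertwiningMap_subrepresentation_parabolicIndGL_eq_zero`,
★ `isSupercuspidal_iff_jacquetGL_holds`, ★ `jacquetAdmissibility_gl_holds`, ★ F1 `K2E3TwoBlockCuspidalSupportEmbedding.eq_id_of_monotone_surjective` (+ its BZ-2.5 road
★ `exists_isCoatom_subrepresentation_jacquetGL`, ★ `IsIrreducible.exists_equiv_quotient_finsupp`, ★ `coinvariantsKer_comp_cutUnipotent_eq_top`, ★ `isSupercuspidal_of_forall_cut`,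
★ `cutRefine_monotone`, ★ `cutRefine_surjective`), ★ `jacquetGLMap{,_injective,_surjective}`, ★ `IntertwiningMap.rangeInverse{,_surjective}`, ★ `isSmooth_smoothInd`,
★ `Subrepresentation.subtypeIntertwiningMap`, ★ `Subrepresentation.quotientRep ∕ mkQ`, ★ `scalar_mem_standardParabolicGL`, ★ `twist_apply`.
Mathlib: `Representation.IntertwiningMap.comp`, `Representation.Equiv`, `Submodule.mkQ`.  Dedup: `rg "isConstituentOf_principalSeries|nontrivial_coinvariants_of_isConstituentOf"` — no hits.

## References
* [BernsteinZelevinsky1977] I. N. Bernstein, A. V. Zelevinsky, *Induced representations of reductive 𝔭-adic groups I*, Ann. Sci. ÉNS 10 (1977), Thm. 2.5, Thm. 2.9.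
* [Casselman1995] W. Casselman, *Introduction to the theory of admissible representations of 𝔭-adic reductive groups* (1995 notes), Cor. 5.4.3, Thm. 6.3.7.
* [Zelevinsky1980] A. V. Zelevinsky, *Induced representations of reductive 𝔭-adic groups II*, Ann. Sci. ÉNS 13 (1980), §1.
-/

set_option autoImplicit false
set_option linter.dupNamespace false

noncomputable section

open scoped MatrixGroups
open Literature.NumberTheory.Automorphic Representation
open Summit.HodgeConjecture.HodgeConjecture.Cruxes.H413.K2E3TwoBlockCuspidalSupportEmbedding

namespace Summit.HodgeConjecture.HodgeConjecture.Cruxes.H413.K2E3GL3PrincipalSeriesConstituentsJacquetNonzero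

variable {F : Type} [Field F] [ValuativeRel F] [TopologicalSpace F] [IsNonarchimedeanLocalField F]

/-- **A supercuspidal quotient of a Jacquet-minimal Jacquet module** — the first half of [BZ77, Thm. 2.5] (★ F1's road, stopped before Frobenius reciprocity): for an
irreducible smooth `π` of `GL_n(F)` and a monotone `c` with `r_c π ≠ 0` and `r_{cutRefine c p} π = 0` for every proper cut, there are an irreducible smooth
SUPERCUSPIDAL representation `σ₀` of the block Levi (on a space in `Type`) and a SURJECTIVE intertwining map `r_c π ↠ σ₀`.
[cite: BernsteinZelevinsky1977, §2.4–2.5, Thm. 2.5 p. 447] [cite: Casselman1995, Thm. 5.1.2, §6.3] -/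
theorem exists_supercuspidal_surjective_of_jacquet_minimal {n : ℕ} {V : Type*} [AddCommGroup V] [Module ℂ V]
    (π : Representation ℂ (GL (Fin n) F) V) [π.IsIrreducible] (hπ : π.IsSmooth)
    {r : ℕ} {c : Fin n → Fin r} (hc : Monotone c)
    (hnt : Nontrivial (restrictUnipotentGL F c π).Coinvariants)
    (hcut : ∀ p q : Fin n, p < q → c q = c p → Subsingleton (restrictUnipotentGL F (cutRefine c p) π).Coinvariants) :
    ∃ (W : Type) (_ : AddCommGroup W) (_ : Module ℂ W) (σ : Representation ℂ (Π a, GL {i // c i = a} F) W),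
      σ.IsIrreducible ∧ σ.IsSmooth ∧ σ.IsSupercuspidal ∧
        ∃ ψ : (jacquetGL F c π).IntertwiningMap σ, Function.Surjective ψ := by
  classical
  haveI : IsTopologicalRing F := inferInstance
  haveI := hnt
  obtain ⟨N, hN⟩ := exists_isCoatom_subrepresentation_jacquetGL F c π hπ
  haveI hirr₀ : N.quotientRep.IsIrreducible := Subrepresentation.isIrreducible_quotientRep hN
  have hsm₀ : N.quotientRep.IsSmooth := (hπ.jacquetGL F c).quotientRep N
  obtain ⟨N', σ₀, ⟨e₀⟩⟩ := IsIrreducible.exists_equiv_quotient_finsupp N.quotientRep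
  haveI hirr : σ₀.IsIrreducible := e₀.isIrreducible
  have hsm : σ₀.IsSmooth := e₀.isSmooth hsm₀
  let ψ : (jacquetGL F c π).IntertwiningMap σ₀ := e₀.toIntertwiningMap.comp N.mkQ
  have hψs : Function.Surjective ψ := fun w => by
    obtain ⟨x, hx⟩ := N.mkQ_surjective (e₀.symm w)
    exact ⟨x, by simp [ψ, hx]⟩
  have hQC : ∀ p q : Fin n, p < q → c q = c p → Coinvariants.ker (σ₀.comp (cutUnipotent F c p).subtype) = ⊤ := by
    intro p q hpq hq
    refine coinvariantsKer_comp_cutUnipotent_eq_top F hc p π ?_ σ₀ ψ hψs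
    have h := hcut p q hpq hq
    change Subsingleton (V ⧸ Coinvariants.ker (restrictUnipotentGL F (cutRefine c p) π)) at h
    exact Submodule.Quotient.subsingleton_iff.1 h
  have hsc₀ : σ₀.IsSupercuspidal := σ₀.isSupercuspidal_of_forall_cut hc hsm hQC
  exact ⟨_, inferInstance, inferInstance, σ₀, hirr, hsm, hsc₀, ψ, hψs⟩

/-- **(E4a) A CONSTITUENT OF A PRINCIPAL SERIES OF `GL₃(F)` HAS A NON-ZERO BOREL JACQUET MODULE — modulo the weak 3-cell lemma `h3cell`.**  For a character `χ`
of the diagonal torus (no continuity hypothesis is needed), `I(χ) = parabolicIndGL F id (𝟙.twist χ)`, and `r` an irreducible smooth constituent of `I(χ)`: if no irreducible smooth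
supercuspidal representation of a two-block Levi is a quotient of a subrepresentation of `r_c(I(χ))` (`c : Fin 3 → Fin 2` monotone surjective) — the content of
Bernstein–Zelevinsky's geometric lemma for `(P_c, B)` together with Casselman's Cor. 5.4.3 on the `GL₂` block (brick (E4b)) — then `r_B(r) ≠ 0`.
[cite: BernsteinZelevinsky1977, Thm. 2.9, Thm. 2.5] [cite: Casselman1995, Cor. 5.4.3, Thm. 6.3.7] -/
theorem nontrivial_coinvariants_of_isConstituentOf_principalSeries_three
    (χ : (Π a : Fin 3, GL {i : Fin 3 // (id : Fin 3 → Fin 3) i = a} F) →* ℂˣ)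
    (h3cell : ∀ c : Fin 3 → Fin 2, Monotone c → Function.Surjective c →
      ∀ (W : Type) [AddCommGroup W] [Module ℂ W] (σ : Representation ℂ (Π a : Fin 2, GL {i : Fin 3 // c i = a} F) W),
        σ.IsIrreducible → σ.IsSmooth → σ.IsSupercuspidal →
        ∀ (N : Subrepresentation (jacquetGL F c (parabolicIndGL F (id : Fin 3 → Fin 3)
            ((Representation.trivial ℂ (Π a : Fin 3, GL {i : Fin 3 // (id : Fin 3 → Fin 3) i = a} F) ℂ).twist χ))))
          (q : N.toRepresentation.IntertwiningMap σ), q = 0)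
    (r : SmoothIrrep (GL (Fin 3) F))
    (hr : (IrrClass.mk r).IsConstituentOf (parabolicIndGL F (id : Fin 3 → Fin 3)
      ((Representation.trivial ℂ (Π a : Fin 3, GL {i : Fin 3 // (id : Fin 3 → Fin 3) i = a} F) ℂ).twist χ))) :
    Nontrivial (restrictUnipotentGL F (id : Fin 3 → Fin 3) r.ρ).Coinvariants := by
  classical
  haveI : IsTopologicalRing F := inferInstance
  -- the principal series and its smoothness
  set I : Representation ℂ (GL (Fin 3) F) _ := parabolicIndGL F (id : Fin 3 → Fin 3)
    ((Representation.trivial ℂ (Π a : Fin 3, GL {i : Fin 3 // (id : Fin 3 → Fin 3) i = a} F) ℂ).twist χ) with hI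
  have hIs : I.IsSmooth := Representation.isSmooth_smoothInd _ _
  -- `r` is admissible (irreducible smooth)
  haveI : r.ρ.IsIrreducible := r.isIrreducible
  have hra : r.ρ.IsAdmissible := jacquetAdmissibility_gl_holds F 3 r.V r.ρ r.isSmooth r.isIrreducible
  -- unpack the constituent: a surjection `q₁ : N₁ ↠ r`
  obtain ⟨r', hr', N₁, N₂, hle, ⟨e⟩⟩ := hr
  obtain ⟨e₁⟩ := (IrrClass.mk_eq_mk_iff r' r).1 hr'
  let mkQ' : N₁.toRepresentation.IntertwiningMap
      (N₁.toRepresentation.quotient (N₂.toSubmodule.comap N₁.toSubmodule.subtype) fun g _ hx => N₂.apply_mem_toSubmodule g hx) :=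
    { toLinearMap := (N₂.toSubmodule.comap N₁.toSubmodule.subtype).mkQ
      isIntertwining' := fun _ => rfl }
  have hmkQ' : Function.Surjective mkQ' := Submodule.mkQ_surjective _
  let q₁ : N₁.toRepresentation.IntertwiningMap r.ρ := e₁.toIntertwiningMap.comp (e.symm.toIntertwiningMap.comp mkQ')
  have hq₁ : Function.Surjective q₁ := by
    intro v
    obtain ⟨x, hx⟩ := hmkQ' (e (e₁.symm v))
    refine ⟨x, ?_⟩
    simp only [q₁, IntertwiningMap.comp_apply, hx]
    change e₁ (e.symm (e (e₁.symm v))) = v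
    rw [e.symm_apply_apply, e₁.apply_symm_apply]
  have hq₁0 : q₁ ≠ 0 := by
    haveI : Nontrivial r.V := IsIrreducible.nontrivial r.ρ
    intro h
    obtain ⟨v, hv⟩ := exists_ne (0 : r.V)
    obtain ⟨x, hx⟩ := hq₁ v
    rw [h] at hx
    exact hv (hx ▸ rfl)
  -- suppose the Borel Jacquet module vanishes
  by_contra hB
  rw [not_nontrivial_iff_subsingleton] at hB
  by_cases hsc : r.ρ.IsSupercuspidal
  · -- (1) `r` supercuspidal: Casselman's Cor. 5.4.3 kills `q₁`
    have hσZ : ∀ u : Fˣ, ∃ cu : ℂ, ∀ w : ℂ,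
        ((Representation.trivial ℂ (Π a : Fin 3, GL {i : Fin 3 // (id : Fin 3 → Fin 3) i = a} F) ℂ).twist χ)
          (leviProjection F (id : Fin 3 → Fin 3) ⟨_, scalar_mem_standardParabolicGL (id : Fin 3 → Fin 3) u⟩) w = cu • w :=
      fun u => ⟨(χ (leviProjection F (id : Fin 3 → Fin 3) ⟨_, scalar_mem_standardParabolicGL (id : Fin 3 → Fin 3) u⟩) : ℂ), fun w => by
        rw [twist_apply]; rfl⟩
    have hcp : IsProperBlocks (id : Fin 3 → Fin 3) := ⟨Function.surjective_id, inferInstance⟩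
    exact hq₁0 (intertwiningMap_subrepresentation_parabolicIndGL_eq_zero monotone_id hcp hσZ hra hsc N₁ q₁)
  · -- (2) `r` not supercuspidal: a proper parabolic with non-zero Jacquet module
    have hcrit := isSupercuspidal_iff_jacquetGL_holds F r.ρ r.isSmooth
    rw [hcrit] at hsc
    push Not at hsc
    obtain ⟨k, c, hcp, hcm, hnt⟩ := hsc
    obtain ⟨hcs, hknt⟩ := hcp
    -- `k ≤ 3` (surjectivity) and `k ≥ 2` (nontriviality); `k = 3` is the Borel, excluded by `hB`
    have hk3 : k ≤ 3 := by simpa using Fintype.card_le_of_surjective c hcs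
    have hk2 : 2 ≤ k := by
      have h := Fintype.one_lt_card_iff_nontrivial.2 hknt
      simp only [Fintype.card_fin] at h
      omega
    interval_cases k
    · -- `k = 2`: the Jacquet-minimal road
      have hcut : ∀ p q : Fin 3, p < q → c q = c p → Subsingleton (restrictUnipotentGL F (cutRefine c p) r.ρ).Coinvariants := by
        intro p q hpq hq
        rw [eq_id_of_monotone_surjective (cutRefine_monotone hcm p) (cutRefine_surjective hcm hcs hpq hq)]
        exact hB
      obtain ⟨W, _, _, σ₀, hσirr, hσsm, hσsc, ψ, hψ⟩ := exists_supercuspidal_surjective_of_jacquet_minimal r.ρ r.isSmooth hcm hnt hcut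
      -- Jacquet functor on `N₁ ↪ I` (injective) and on `q₁ : N₁ ↠ r` (surjective)
      let ι : N₁.toRepresentation.IntertwiningMap I := Literature.RepresentationTheory.FiniteGroups.Subrepresentation.subtypeIntertwiningMap N₁
      have hι : Function.Injective ι := Subtype.val_injective
      have hjι : Function.Injective (jacquetGLMap F c ι) := jacquetGLMap_injective hcm hIs ι hι
      have hjq : Function.Surjective (jacquetGLMap F c q₁) := jacquetGLMap_surjective q₁ hq₁
      -- the offending map: `(r_c N₁ ≅ its image in r_c I) ↠ r_c r ↠ σ₀`
      let q : (jacquetGLMap F c ι).range.toRepresentation.IntertwiningMap σ₀ :=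
        (ψ.comp (jacquetGLMap F c q₁)).comp ((jacquetGLMap F c ι).rangeInverse hjι)
      have hqs : Function.Surjective q :=
        (hψ.comp hjq).comp (IntertwiningMap.rangeInverse_surjective _ hjι)
      have hq0 : q ≠ 0 := by
        haveI : σ₀.IsIrreducible := hσirr
        haveI : Nontrivial W := IsIrreducible.nontrivial σ₀
        intro h
        obtain ⟨w, hw⟩ := exists_ne (0 : W)
        obtain ⟨x, hx⟩ := hqs w
        rw [h] at hx
        exact hw (hx ▸ rfl)
      exact hq0 (h3cell c hcm hcs W σ₀ hσirr hσsm hσsc _ q)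
    · -- `k = 3`: the labelling is the Borel
      obtain rfl : c = id := eq_id_of_monotone_surjective hcm hcs
      exact (not_nontrivial_iff_subsingleton.2 hB) hnt

/-- **(E4a, tuple form)** the same for the principal series `I(θ) = Ind_B(θ₁ ⊗ θ₂ ⊗ θ₃)` of a triple of characters `θ : Fin 3 → (Fˣ →* ℂˣ)`, with the leaf owner's
tuple character `tch θ = ∏ a, (θ a) ∘ det ∘ eval a` (K2E3-p25 (g0), CONVENTIONS 08:40:11Z). [cite: BernsteinZelevinsky1977, Thm. 2.9] [cite: Casselman1995, Thm. 6.3.7] -/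
theorem nontrivial_coinvariants_of_isConstituentOf_principalSeries_three_tuple (θ : Fin 3 → (Fˣ →* ℂˣ))
    (h3cell : ∀ c : Fin 3 → Fin 2, Monotone c → Function.Surjective c →
      ∀ (W : Type) [AddCommGroup W] [Module ℂ W] (σ : Representation ℂ (Π a : Fin 2, GL {i : Fin 3 // c i = a} F) W),
        σ.IsIrreducible → σ.IsSmooth → σ.IsSupercuspidal →
        ∀ (N : Subrepresentation (jacquetGL F c (parabolicIndGL F (id : Fin 3 → Fin 3)
            ((Representation.trivial ℂ (Π a : Fin 3, GL {i : Fin 3 // (id : Fin 3 → Fin 3) i = a} F) ℂ).twist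
              (∏ a : Fin 3, (θ a).comp (Matrix.GeneralLinearGroup.det.comp
                (Pi.evalMonoidHom (fun a : Fin 3 => GL {i : Fin 3 // (id : Fin 3 → Fin 3) i = a} F) a)))))))
          (q : N.toRepresentation.IntertwiningMap σ), q = 0)
    (r : SmoothIrrep (GL (Fin 3) F))
    (hr : (IrrClass.mk r).IsConstituentOf (parabolicIndGL F (id : Fin 3 → Fin 3)
      ((Representation.trivial ℂ (Π a : Fin 3, GL {i : Fin 3 // (id : Fin 3 → Fin 3) i = a} F) ℂ).twist
        (∏ a : Fin 3, (θ a).comp (Matrix.GeneralLinearGroup.det.comp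
          (Pi.evalMonoidHom (fun a : Fin 3 => GL {i : Fin 3 // (id : Fin 3 → Fin 3) i = a} F) a)))))) :
    Nontrivial (restrictUnipotentGL F (id : Fin 3 → Fin 3) r.ρ).Coinvariants :=
  nontrivial_coinvariants_of_isConstituentOf_principalSeries_three _ h3cell r hr

end Summit.HodgeConjecture.HodgeConjecture.Cruxes.H413.K2E3GL3PrincipalSeriesConstituentsJacquetNonzero

end
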